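import Summits.ResolutionOfSingularities.ResolutionOfSingularities.Theorems.MarkedTransferCampaignW46TameRidgeFunctor
import Summits.ResolutionOfSingularities.ResolutionOfSingularities.Theorems.MarkedTransferCampaignW31HasseStableOfLeibniz
import Literature.AlgebraicGeometry.Resolution.PointBlowupRidge
import HarnessLib

/-!
# [OURS · L1 W4.6, rung (iv) support] The ridge ideal of a hypersurface cone is generated by the Hasse–Schmidt
# coefficients of the form — a proof of the tree's named fact `PrincipalRidgeIdealEqSpanHasse`
# (Berthomieu–Hivert–Mourtada, Cor. 2.3 after Giraud, principal case), in every characteristic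
# (cell res-hironaka, LADDER-RESOLUTION rung L, D-0089; slot W4.6, seat res-L1-s46-pv-7; host route MarkedTransfer,
# `--supports stmt-ResolutionOfSingularities-16155 --as helper`)

HONEST FRAMING. Nothing here is a statement of H. Hironaka's manuscript (2017-03-23, [Hironaka2017]) and nothing here
asserts that any statement of it holds. This file DISCHARGES a named fact of the tree's Literature layer,
`Literature.AlgebraicGeometry.Resolution.PrincipalRidgeIdealEqSpanHasse K n` (`PointBlowupRidge.lean`: «NAMED FACT (BHM
Cor. 2.3, after Giraud, principal case) … Not proved in the tree»): for a form `h` of degree `d`, the ideal `𝔉((h))`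
of Giraud's ridge of the cone `h = 0` (`RidgeRepresentable.lean`: `ridgeIdeal`, representing the ridge functor) is
generated by the Hasse–Schmidt coefficients `𝓔(h) = {D_A h : |A| < d}`. Self-contained commutative algebra over the
tree (`ridge`, `ridgeIdeal`, `mem_ridge_iff_forall_ridgeIdeal`, `hasseDeriv`, `taylor`, `hasseD`) and this seat's
`TameRidgeFunctor` (the ridge of a form is its Hasse stabiliser); no premise of the manuscript, no FACT-LIST premise.
AI review is weaker than expert review. No `sorry`, no definition; axioms standard.

## Proof route

1. Hasse–Schmidt derivatives commute with base change (tree: `CampaignW31.map_hasseDeriv`).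
2. `coeff_hasseDeriv_comm` — the SYMMETRY `coeff_β(D^{(α)} f) = coeff_α(D^{(β)} f)` (both are
   `C(α+β, α) · coeff_{α+β}(f)`; `h(x + u) = h(u + x)`).
3. `coeff_hasseD_eq_eval_hasseDeriv` — for a form `H` of degree `d` and `|β| < d`:
   `coeff_β(D_v^{(d−|β|)} H) = (D^{(β)} H)(v)` (expand `D_v^{(j)} = Σ_{|α|=j} v^α D^{(α)}` and use 2.).
   Hence `forall_hasseD_eq_zero_iff_forall_eval_hasseDeriv`: all positive-order directional Hasse derivatives of `H`
   along `v` vanish iff `v` is a common zero of `𝓔(H)`.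
4. With `TameRidgeFunctor.mem_ridge_span_singleton_iff_forall_hasseD` (ridge = Hasse stabiliser on every commutative
   `K`-algebra in the universe of `K`): `mem_ridge_span_singleton_iff_forall_hasseCoefficients` — the ridge functor of
   `(h)` and the functor of points of `V(⟨𝓔(h)⟩)` AGREE on all `K`-algebras.
5. `Ideal.le_of_forall_aeval` — Yoneda for ideals of `K[X]` (test on the tautological point of `K[X]/J`); with the
   representability `mem_ridge_iff_forall_ridgeIdeal` of the tree: `principalRidgeIdealEqSpanHasse_holds`.

Relevance to W4.6 (iv): this is the all-characteristic structure statement behind `TameRidge`/`TameRidgeFunctor`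
(regime (iv): the generators of `p`-power degree are the linear ones iff `d < p`), and it serves the W4.2 ridge line and
the atlas (`PointBlowupRidge.lean`, whose second named fact `PrincipalRidgeIdealEqSpanHassePPow` — BHM Lemma 3.6 — is
NOT proved here).

## References (context; the discharged statement is the tree's)

* J. Berthomieu, P. Hivert, H. Mourtada, Contemp. Math. 521 (2010), Prop.–Def. 2.1, Cor. 2.3, Def. 2.4.
  [cite: BerthomieuHivertMourtada2010, Prop. 2.1, Cor. 2.3, Def. 2.4]
* J. Giraud, Ann. Sci. ÉNS 8 (1975) §1.5–1.6. [cite: Giraud1975, §1.5]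
* EGA IV₄ 16.11.2 (Hasse–Schmidt binomial formula). [cite: EGAIV4, Thm. 16.11.2]
-/

noncomputable section

set_option linter.dupNamespace false -- mandated namespace of this single-conjunct summit

namespace Summit.ResolutionOfSingularities.ResolutionOfSingularities.Theorems
namespace CampaignW46
namespace PrincipalRidgeHasse

open MvPolynomial
open Literature.RingTheory.MvPolynomial
open Literature.AlgebraicGeometry.Resolution
open Literature.AlgebraicGeometry.Resolution.WeightedBlowup.HasseDir

universe u v

/-! ## 1. Hasse–Schmidt derivatives and base change: the tree's `CampaignW31.map_hasseDeriv`
(`MarkedTransferCampaignW31HasseStableOfLeibniz.lean`) is reused, not restated. -/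

/-! ## 2. The symmetry `coeff_β(D^{(α)} f) = coeff_α(D^{(β)} f)` -/

section Symmetry

variable {σ : Type*} [DecidableEq σ] {R : Type*} [CommRing R]

/-- Closed formula: `coeff_β(D^{(α)}(c x^δ)) = [δ = α + β] · (Π_{i ∈ supp α} C(δ_i, α_i)) · c`. [folklore] -/
theorem coeff_hasseDeriv_monomial (α β δ : σ →₀ ℕ) (c : R) :
    coeff β (hasseDeriv R α (monomial δ c)) =
      if δ = α + β then ((∏ i ∈ α.support, (δ i).choose (α i) : ℕ) : R) * c else 0 := by
  by_cases hle : α ≤ δ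
  · rw [hasseDeriv_monomial, ← map_natCast C, C_mul_monomial, coeff_monomial]
    by_cases h : δ = α + β
    · rw [if_pos (by rw [h, add_tsub_cancel_left]), if_pos h]
    · rw [if_neg, if_neg h]
      intro h'
      exact h (by rw [← h', add_tsub_cancel_of_le hle])
  · rw [hasseDeriv_monomial_eq_zero_of_not_le R hle, coeff_zero, if_neg]
    intro h
    exact hle (h ▸ le_self_add)

/-- The binomial product is symmetric: `Π_{supp α} C(α_i+β_i, α_i) = Π_{supp β} C(α_i+β_i, β_i)`. [folklore] -/
theorem prod_choose_comm (α β : σ →₀ ℕ) :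
    (∏ i ∈ α.support, ((α + β) i).choose (α i)) = ∏ i ∈ β.support, ((α + β) i).choose (β i) := by
  have hA : (∏ i ∈ α.support, ((α + β) i).choose (α i)) =
      ∏ i ∈ α.support ∪ β.support, ((α + β) i).choose (α i) := by
    refine Finset.prod_subset Finset.subset_union_left fun i _ hi => ?_
    rw [Finsupp.notMem_support_iff.mp hi, Nat.choose_zero_right]
  have hB : (∏ i ∈ β.support, ((α + β) i).choose (β i)) =
      ∏ i ∈ α.support ∪ β.support, ((α + β) i).choose (β i) := by
    refine Finset.prod_subset Finset.subset_union_right fun i _ hi => ?_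
    rw [Finsupp.notMem_support_iff.mp hi, Nat.choose_zero_right]
  rw [hA, hB]
  refine Finset.prod_congr rfl fun i _ => ?_
  rw [Finsupp.add_apply, Nat.choose_symm_add]

/-- **Symmetry of the Hasse–Schmidt coefficients** (`h(x + u) = h(u + x)`): `coeff_β(D^{(α)} f) = coeff_α(D^{(β)} f)`.
[folklore] -/
theorem coeff_hasseDeriv_comm (α β : σ →₀ ℕ) (G : MvPolynomial σ R) :
    coeff β (hasseDeriv R α G) = coeff α (hasseDeriv R β G) := by
  induction G using MvPolynomial.induction_on' with
  | monomial δ c =>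
    rw [coeff_hasseDeriv_monomial, coeff_hasseDeriv_monomial]
    by_cases h : δ = α + β
    · rw [if_pos h, if_pos (by rw [h, add_comm]), h, prod_choose_comm, add_comm α β]
    · rw [if_neg h, if_neg (by rwa [add_comm])]
  | add p q hp hq => rw [map_add, map_add, coeff_add, coeff_add, hp, hq]

omit [DecidableEq σ] in
/-- A non-zero Hasse derivative shows up in the Taylor support. [folklore] -/
theorem mem_support_taylor_of_hasseDeriv_ne_zero {α : σ →₀ ℕ} {G : MvPolynomial σ R}
    (h : hasseDeriv R α G ≠ 0) : α ∈ (taylor R G).support := by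
  rw [mem_support_iff, ← hasseDeriv_apply]
  exact h

end Symmetry

/-! ## 3. Directional Hasse derivatives versus the values of the Hasse coefficients -/

section Values

variable {σ : Type*} [DecidableEq σ] {S : Type*} [CommRing S]

/-- **`coeff_β(D_v^{(d−|β|)} H) = (D^{(β)} H)(v)`** for a form `H` of degree `d` (truncated subtraction: for `|β| ≥ d`
both sides are `coeff_β H` read as a constant). [folklore] -/
theorem coeff_hasseD_eq_eval_hasseDeriv {H : MvPolynomial σ S} {d : ℕ} (hH : H.IsHomogeneous d) (v : σ → S)
    (β : σ →₀ ℕ) : coeff β (hasseD v (d - β.degree) H) = eval v (hasseDeriv S β H) := by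
  classical
  rw [hasseD_eq_sum_hasseDeriv, coeff_sum, eval_eq]
  simp only [coeff_C_mul]
  -- both sides are sums of `v^α · coeff_α(D^{(β)} H)`; compare index sets
  have hhom : (hasseDeriv S β H).IsHomogeneous (d - β.degree) := TameRidgeFunctor.isHomogeneous_hasseDeriv hH β
  have hsub : (hasseDeriv S β H).support ⊆
      (taylor S H).support.filter fun α => α.degree = d - β.degree := by
    intro α hα
    rw [Finset.mem_filter]
    have hne : coeff α (hasseDeriv S β H) ≠ 0 := mem_support_iff.mp hα
    refine ⟨?_, ?_⟩
    · apply mem_support_taylor_of_hasseDeriv_ne_zero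
      intro h0
      apply hne
      rw [← coeff_hasseDeriv_comm, h0, coeff_zero]
    · by_contra hdeg
      exact hne (hhom.coeff_eq_zero hdeg)
  rw [Finset.sum_subset hsub (fun α _ hα => by rw [notMem_support_iff.mp hα, zero_mul])]
  refine Finset.sum_congr rfl fun α _ => ?_
  rw [coeff_hasseDeriv_comm, mul_comm, Finsupp.prod]

/-- **Directional Hasse derivatives vanish iff the Hasse coefficients vanish at the direction**: for a form `H` of
degree `d`, `(∀ j ≥ 1, D_v^{(j)} H = 0) ↔ (∀ β, |β| < d → (D^{(β)} H)(v) = 0)`. [folklore] -/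
theorem forall_hasseD_eq_zero_iff_forall_eval_hasseDeriv {H : MvPolynomial σ S} {d : ℕ} (hH : H.IsHomogeneous d)
    (v : σ → S) :
    (∀ j : ℕ, 1 ≤ j → hasseD v j H = 0) ↔
      ∀ β : σ →₀ ℕ, β.degree < d → eval v (hasseDeriv S β H) = 0 := by
  classical
  constructor
  · intro h β hβ
    rw [← coeff_hasseD_eq_eval_hasseDeriv hH v β, h (d - β.degree) (by omega), coeff_zero]
  · intro h j hj
    ext β
    rw [coeff_zero]
    by_cases hβ : β.degree + j = d
    · have hβ' : β.degree < d := by omega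
      have hj' : j = d - β.degree := by omega
      rw [hj', coeff_hasseD_eq_eval_hasseDeriv hH v β, h β hβ']
    · -- every term of `coeff_β(D_v^{(j)} H) = Σ_{|α| = j} v^α coeff_β(D^{(α)} H)` vanishes by homogeneity
      rw [hasseD_eq_sum_hasseDeriv, coeff_sum]
      refine Finset.sum_eq_zero fun α hα => ?_
      rw [Finset.mem_filter] at hα
      rw [coeff_C_mul, coeff_hasseDeriv_comm,
        (TameRidgeFunctor.isHomogeneous_hasseDeriv hH β).coeff_eq_zero (by omega), mul_zero]

end Values

/-! ## 4. The ridge functor of `(h)` is the functor of points of `V(⟨𝓔(h)⟩)` -/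

section RidgePoints

variable {K : Type u} [Field K] {n : ℕ}

/-- Base change of the values of the Hasse coefficients: `(D^{(A)} h)(v) = (D^{(A)} (h ⊗ 1))(v)`. [folklore] -/
theorem aeval_hasseDeriv {k' : Type v} [CommRing k'] [Algebra K k'] (v : Fin n → k') (A : Fin n →₀ ℕ)
    (h : MvPolynomial (Fin n) K) :
    aeval v (hasseDeriv K A h) = eval v (hasseDeriv k' A (MvPolynomial.map (algebraMap K k') h)) := by
  rw [← CampaignW31.map_hasseDeriv, eval_map, aeval_def]

/-- **The ridge functor of a hypersurface cone is cut out by the Hasse coefficients**: for a form `h` of degree `d`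
and every commutative `K`-algebra `k'` (universe of `K`), `v ∈ F(k')` iff `g(v) = 0` for all
`g ∈ 𝓔(h) = {D^{(A)} h : |A| < d}` (tree `hasseCoefficients`). Every characteristic. [folklore] -/
theorem mem_ridge_span_singleton_iff_forall_hasseCoefficients {k' : Type u} [CommRing k'] [Algebra K k']
    {h : MvPolynomial (Fin n) K} {d : ℕ} (hh : h.IsHomogeneous d) (v : Fin n → k') :
    v ∈ ridge k' (Ideal.span {h}) ↔ ∀ g ∈ hasseCoefficients d h, aeval v g = 0 := by
  classical
  rw [TameRidgeFunctor.mem_ridge_span_singleton_iff_forall_hasseD hh,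
    forall_hasseD_eq_zero_iff_forall_eval_hasseDeriv (hh.map _) v]
  constructor
  · rintro H g ⟨A, hA, rfl⟩
    rw [aeval_hasseDeriv]
    exact H A hA
  · intro H A hA
    rw [← aeval_hasseDeriv]
    exact H _ ⟨A, hA, rfl⟩

/-! ## 5. Yoneda for ideals of `K[X]` and the discharge of the named fact -/

/-- The tautological point of `K[X]/J` evaluates every polynomial to its residue class. [folklore] -/
theorem aeval_quotient_mk_X (J : Ideal (MvPolynomial (Fin n) K)) (g : MvPolynomial (Fin n) K) :
    aeval (fun i => Ideal.Quotient.mk J (X i)) g = Ideal.Quotient.mk J g := by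
  have hφ : aeval (fun i => Ideal.Quotient.mk J (X i : MvPolynomial (Fin n) K)) = Ideal.Quotient.mkₐ K J :=
    MvPolynomial.algHom_ext fun i => by rw [aeval_X, Ideal.Quotient.mkₐ_eq_mk]
  exact AlgHom.congr_fun hφ g

/-- **Yoneda for ideals**: if every `k'`-point (all commutative `K`-algebras `k'` in the universe of `K`) killing
`J₁` kills `J₂`, then `J₂ ⊆ J₁` (test on the tautological point of `K[X]/J₁`). [folklore] -/
theorem le_of_forall_aeval_eq_zero {J₁ J₂ : Ideal (MvPolynomial (Fin n) K)}
    (H : ∀ (k' : Type u) [CommRing k'] [Algebra K k'] (v : Fin n → k'),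
      (∀ g ∈ J₁, aeval v g = 0) → ∀ g ∈ J₂, aeval v g = 0) : J₂ ≤ J₁ := by
  intro g hg
  have key := H (MvPolynomial (Fin n) K ⧸ J₁) (fun i => Ideal.Quotient.mk J₁ (X i)) (fun g' hg' => by
    rw [aeval_quotient_mk_X, Ideal.Quotient.eq_zero_iff_mem]
    exact hg') g hg
  rwa [aeval_quotient_mk_X, Ideal.Quotient.eq_zero_iff_mem] at key

/-- [OURS · L1 W4.6 (iv) support; a discharge of the tree's named fact, NOT a statement of the manuscript]
**The ridge ideal of the cone of a form is generated by its Hasse–Schmidt coefficients**: for `h` homogeneous of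
degree `d`, `𝔉((h)) = ⟨D^{(A)} h : |A| < d⟩` (BHM Cor. 2.3, after Giraud, principal case; every characteristic;
`h ≠ 0` is not needed). [folklore] -/
theorem ridgeIdeal_span_singleton_eq_span_hasseCoefficients {h : MvPolynomial (Fin n) K} {d : ℕ}
    (hh : h.IsHomogeneous d) : ridgeIdeal (Ideal.span {h}) = Ideal.span (hasseCoefficients d h) := by
  apply le_antisymm
  · refine le_of_forall_aeval_eq_zero fun k' _ _ v hv => ?_
    have hmem : v ∈ ridge k' (Ideal.span {h}) :=
      (mem_ridge_span_singleton_iff_forall_hasseCoefficients hh v).mpr fun g hg => hv g (Ideal.subset_span hg)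
    exact mem_ridge_iff_forall_ridgeIdeal.mp hmem
  · refine le_of_forall_aeval_eq_zero fun k' _ _ v hv => ?_
    have hmem : v ∈ ridge k' (Ideal.span {h}) := mem_ridge_iff_forall_ridgeIdeal.mpr hv
    have h𝓔 := (mem_ridge_span_singleton_iff_forall_hasseCoefficients hh v).mp hmem
    have hle : Ideal.span (hasseCoefficients d h) ≤ RingHom.ker ((aeval v).toRingHom) :=
      Ideal.span_le.mpr fun g hg => h𝓔 g hg
    intro g hg
    exact hle hg

/-- **Discharge of the tree's named fact** `Literature.AlgebraicGeometry.Resolution.PrincipalRidgeIdealEqSpanHasse`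
(`PointBlowupRidge.lean`: BHM Cor. 2.3, principal case — «Not proved in the tree» until now). [folklore] -/
theorem principalRidgeIdealEqSpanHasse_holds : PrincipalRidgeIdealEqSpanHasse K n :=
  fun _ _ hh _ => ridgeIdeal_span_singleton_eq_span_hasseCoefficients hh

end RidgePoints


end PrincipalRidgeHasse
end CampaignW46
end Summit.ResolutionOfSingularities.ResolutionOfSingularities.Theorems

end
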